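import Summits.SmoothPoincare4.SmoothPoincare4.Theses.CongruenceShadows

/-!
# SmoothPoincare4 / CongruenceShadows — assembly

Settles item stmt-SmoothPoincare4-14600 (assembly of route CongruenceShadows, rev 1):
`NormalFormStablyTrivial → WaldhausenPairs → GenusZero → AgkCor6Sufficiency → SmoothPoincare4`.

Pure logic.  `AgkCor6Sufficiency` (Abrams–Gay–Kirby Cor. 6, direction ⇐, kernel form) reduces
`SmoothPoincare4` to: every `(3k, k)` kernel triple `K` that is a group trisection of the trivial
group is stably trivial.  For `k = 0` this is `GenusZero`; for `k = m + 1` one rewrites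
`3 (m + 1) = 3 + 3 m` (a `subst` on a generalised genus) and applies
`NormalFormStablyTrivial m K hK (WaldhausenPairs m K hK)`.  This is exactly the route file's own
deciding theorem `CongruenceShadows.closes`; nothing else is used (no named facts).
-/

-- the registered namespace `Summit.SmoothPoincare4.SmoothPoincare4.Theorems` repeats a component
set_option linter.dupNamespace false

namespace Summit.SmoothPoincare4.SmoothPoincare4.Theorems

open Summit.SmoothPoincare4.SmoothPoincare4.Theses.CongruenceShadows

/-- Settles stmt-SmoothPoincare4-14600: the assembly
`NormalFormStablyTrivial → WaldhausenPairs → GenusZero → AgkCor6Sufficiency → SmoothPoincare4` of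
route CongruenceShadows.  Proof: unfold `Assembly` and apply the route's deciding theorem
`CongruenceShadows.closes` (feed `AgkCor6Sufficiency` the `k`-induction: `k = 0` is `GenusZero`,
`k = m + 1` is `NormalFormStablyTrivial` after `WaldhausenPairs` normalises the three Heegaard pairs,
transported along `3 (m + 1) = 3 + 3 m`). [folklore] -/
theorem CongruenceShadows_Assembly_proof :
    Summit.SmoothPoincare4.SmoothPoincare4.Theses.CongruenceShadows.Assembly := by
  unfold Assembly
  intro hX hW h0 hAGK
  exact closes hX hW h0 hAGK

end Summit.SmoothPoincare4.SmoothPoincare4.Theorems
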